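import Mathlib.Analysis.SpecialFunctions.Pow.Real
import Mathlib.Analysis.SpecialFunctions.Sqrt
import HarnessLib

/-!
# Weight algebra for the cross-term error sums of the BCH mean square

Topic `Literature/NumberTheory/LFunctions`. Everything in this file is PROVED (no definitions, no
named facts). Pure real algebra: the weights `(hk)^{-1/2} μ^{-1/2}` of the quadruple sums of
`Literature/NumberTheory/LFunctions/BCHCrossTermStationaryPhase.lean` against the slope
`κ = 2πμh/k` of the stationary point `c = κν`:

* `BCH.weight_div_sqrt_slope_mul` — `(hk)^{-1/2} μ^{-1/2} / √(κ D) = 1/(√(2πD) · h · μ)`;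
* `BCH.weight_mul_sqrt_slope` — `(hk)^{-1/2} μ^{-1/2} · √κ = √(2π)/k`;
* `BCH.weight_div_sqrt_slope_mul_sq` — `(hk)^{-1/2} μ^{-1/2} / √(κ · 2πμ²) = 1/(2π h μ²)`;
* `BCH.weight_le_of_sqrt` — `(hk)^{-1/2} μ^{-1/2} ν^{-1/2} = 1/(√h √k √μ √ν)` and the factorised bound.

## References

* [Levinson1974] N. Levinson, Adv. Math. 13 (1974), §5 (the bookkeeping of `Σ E(r)`).
-/

noncomputable section

open Real

namespace Literature.NumberTheory.LFunctions.BCH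

/-- `x^{-1/2} = 1/√x` for `x ≥ 0`. [folklore] -/
theorem rpow_neg_half_eq_inv_sqrt {x : ℝ} (hx : 0 ≤ x) : x ^ (-(1 / 2 : ℝ)) = 1 / Real.sqrt x := by
  rw [Real.rpow_neg hx, ← Real.sqrt_eq_rpow, one_div]

/-- The slope `κ = 2πμh/k` is positive. [folklore] -/
theorem slope_pos {h k μ : ℕ} (hh : 0 < h) (hk : 0 < k) (hμ : 0 < μ) :
    0 < 2 * π * (μ : ℝ) * h / k := by
  have : (0 : ℝ) < h := by exact_mod_cast hh
  have : (0 : ℝ) < k := by exact_mod_cast hk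
  have : (0 : ℝ) < μ := by exact_mod_cast hμ
  positivity

/-- `√κ = √(2π) √μ √h / √k`. [folklore] -/
theorem sqrt_slope_eq (h k μ : ℕ) :
    Real.sqrt (2 * π * (μ : ℝ) * h / k) =
      Real.sqrt (2 * π) * Real.sqrt μ * Real.sqrt h / Real.sqrt k := by
  rw [Real.sqrt_div' _ (Nat.cast_nonneg k), Real.sqrt_mul (by positivity), Real.sqrt_mul (by positivity)]

/-- **`(hk)^{-1/2} μ^{-1/2} / √(κD) = 1/(√(2πD) h μ)`** (`κ = 2πμh/k`, `D > 0`). [folklore] -/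
theorem weight_div_sqrt_slope_mul {h k μ : ℕ} (hh : 0 < h) (hk : 0 < k) (hμ : 0 < μ) {D : ℝ} (hD : 0 < D) :
    ((h : ℝ) * k) ^ (-(1 / 2 : ℝ)) * (μ : ℝ) ^ (-(1 / 2 : ℝ)) / Real.sqrt (2 * π * (μ : ℝ) * h / k * D) =
      1 / (Real.sqrt (2 * π * D) * h * μ) := by
  have hhR : (0 : ℝ) < h := by exact_mod_cast hh
  have hkR : (0 : ℝ) < k := by exact_mod_cast hk
  have hμR : (0 : ℝ) < μ := by exact_mod_cast hμ
  set rh := Real.sqrt h with hrh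
  set rk := Real.sqrt k with hrk
  set rμ := Real.sqrt μ with hrμ
  set rD := Real.sqrt (2 * π * D) with hrD
  have hrh0 : 0 < rh := Real.sqrt_pos.2 hhR
  have hrk0 : 0 < rk := Real.sqrt_pos.2 hkR
  have hrμ0 : 0 < rμ := Real.sqrt_pos.2 hμR
  have hrD0 : 0 < rD := Real.sqrt_pos.2 (by positivity)
  have eh : (h : ℝ) = rh * rh := (Real.mul_self_sqrt hhR.le).symm
  have eμ : (μ : ℝ) = rμ * rμ := (Real.mul_self_sqrt hμR.le).symm
  have e1 : ((h : ℝ) * k) ^ (-(1 / 2 : ℝ)) = 1 / (rh * rk) := by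
    rw [rpow_neg_half_eq_inv_sqrt (by positivity), Real.sqrt_mul hhR.le]
  have e2 : (μ : ℝ) ^ (-(1 / 2 : ℝ)) = 1 / rμ := rpow_neg_half_eq_inv_sqrt hμR.le
  have e3 : Real.sqrt (2 * π * (μ : ℝ) * h / k * D) = rD * rμ * rh / rk := by
    rw [show 2 * π * (μ : ℝ) * h / k * D = (2 * π * D) * μ * h / k by ring,
      Real.sqrt_div' _ hkR.le, Real.sqrt_mul (by positivity), Real.sqrt_mul (by positivity)]
  rw [e1, e2, e3]
  conv_rhs => rw [eh, eμ]
  field_simp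

/-- **`(hk)^{-1/2} μ^{-1/2} √κ = √(2π)/k`**. [folklore] -/
theorem weight_mul_sqrt_slope {h k μ : ℕ} (hh : 0 < h) (hk : 0 < k) (hμ : 0 < μ) :
    ((h : ℝ) * k) ^ (-(1 / 2 : ℝ)) * (μ : ℝ) ^ (-(1 / 2 : ℝ)) * Real.sqrt (2 * π * (μ : ℝ) * h / k) =
      Real.sqrt (2 * π) / k := by
  have hhR : (0 : ℝ) < h := by exact_mod_cast hh
  have hkR : (0 : ℝ) < k := by exact_mod_cast hk
  have hμR : (0 : ℝ) < μ := by exact_mod_cast hμ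
  have hsh : Real.sqrt h ≠ 0 := (Real.sqrt_pos.2 hhR).ne'
  have hsk : Real.sqrt k ≠ 0 := (Real.sqrt_pos.2 hkR).ne'
  have hsμ : Real.sqrt μ ≠ 0 := (Real.sqrt_pos.2 hμR).ne'
  have e1 : ((h : ℝ) * k) ^ (-(1 / 2 : ℝ)) = 1 / (Real.sqrt h * Real.sqrt k) := by
    rw [rpow_neg_half_eq_inv_sqrt (by positivity), Real.sqrt_mul hhR.le]
  have e2 : (μ : ℝ) ^ (-(1 / 2 : ℝ)) = 1 / Real.sqrt μ := rpow_neg_half_eq_inv_sqrt hμR.le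
  rw [e1, e2, sqrt_slope_eq]
  conv_rhs => rw [show (k : ℝ) = Real.sqrt k * Real.sqrt k from (Real.mul_self_sqrt hkR.le).symm]
  field_simp

/-- **`(hk)^{-1/2} μ^{-1/2} / √(κ · 2πμ²) = 1/(2π h μ²)`**. [folklore] -/
theorem weight_div_sqrt_slope_mul_sq {h k μ : ℕ} (hh : 0 < h) (hk : 0 < k) (hμ : 0 < μ) :
    ((h : ℝ) * k) ^ (-(1 / 2 : ℝ)) * (μ : ℝ) ^ (-(1 / 2 : ℝ)) /
        Real.sqrt (2 * π * (μ : ℝ) * h / k * (2 * π * (μ : ℝ) ^ 2)) = 1 / (2 * π * h * (μ : ℝ) ^ 2) := by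
  have hhR : (0 : ℝ) < h := by exact_mod_cast hh
  have hkR : (0 : ℝ) < k := by exact_mod_cast hk
  have hμR : (0 : ℝ) < μ := by exact_mod_cast hμ
  set rh := Real.sqrt h with hrh
  set rk := Real.sqrt k with hrk
  set rμ := Real.sqrt μ with hrμ
  have hrh0 : 0 < rh := Real.sqrt_pos.2 hhR
  have hrk0 : 0 < rk := Real.sqrt_pos.2 hkR
  have hrμ0 : 0 < rμ := Real.sqrt_pos.2 hμR
  have eh : (h : ℝ) = rh * rh := (Real.mul_self_sqrt hhR.le).symm
  have eμ : (μ : ℝ) = rμ * rμ := (Real.mul_self_sqrt hμR.le).symm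
  have e1 : ((h : ℝ) * k) ^ (-(1 / 2 : ℝ)) = 1 / (rh * rk) := by
    rw [rpow_neg_half_eq_inv_sqrt (by positivity), Real.sqrt_mul hhR.le]
  have e2 : (μ : ℝ) ^ (-(1 / 2 : ℝ)) = 1 / rμ := rpow_neg_half_eq_inv_sqrt hμR.le
  have e3 : Real.sqrt (2 * π * (μ : ℝ) * h / k * (2 * π * (μ : ℝ) ^ 2)) = 2 * π * μ * (rμ * rh / rk) := by
    rw [show 2 * π * (μ : ℝ) * h / k * (2 * π * (μ : ℝ) ^ 2) = (2 * π * μ) ^ 2 * (μ * h / k) by ring,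
      Real.sqrt_mul (by positivity), Real.sqrt_sq (by positivity), Real.sqrt_div' _ hkR.le,
      Real.sqrt_mul hμR.le]
  rw [e1, e2, e3]
  conv_rhs => rw [eh]
  rw [eμ]
  field_simp

/-- The full weight factorises: `(hk)^{-1/2} (μν)^{-1/2} = (1/√h)(1/√k)(1/√μ)(1/√ν)`. [folklore] -/
theorem weight_factor (h k μ ν : ℕ) :
    ((h : ℝ) * k) ^ (-(1 / 2 : ℝ)) * ((μ : ℝ) * ν) ^ (-(1 / 2 : ℝ)) =
      (1 / Real.sqrt h) * (1 / Real.sqrt k) * ((1 / Real.sqrt μ) * (1 / Real.sqrt ν)) := by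
  rw [rpow_neg_half_eq_inv_sqrt (by positivity), rpow_neg_half_eq_inv_sqrt (by positivity),
    Real.sqrt_mul (Nat.cast_nonneg h), Real.sqrt_mul (Nat.cast_nonneg μ)]
  field_simp

/-- `(μν)^{-1/2} = μ^{-1/2} ν^{-1/2}`. [folklore] -/
theorem rpow_mul_natCast (μ ν : ℕ) :
    ((μ : ℝ) * ν) ^ (-(1 / 2 : ℝ)) = (μ : ℝ) ^ (-(1 / 2 : ℝ)) * (ν : ℝ) ^ (-(1 / 2 : ℝ)) :=
  Real.mul_rpow (Nat.cast_nonneg μ) (Nat.cast_nonneg ν)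

/-- For `μ` beyond the activation threshold, `2πμ² > T`: `1/μ² ≤ √(2π/T) · (1/μ)`. [folklore] -/
theorem inv_sq_le_of_act {T : ℝ} (hT : 0 < T) {μ : ℕ} (hμ : 0 < μ) (hact : T < 2 * π * (μ : ℝ) ^ 2) :
    1 / (μ : ℝ) ^ 2 ≤ Real.sqrt (2 * π / T) * (1 / μ) := by
  have hμR : (0 : ℝ) < μ := by exact_mod_cast hμ
  have h1 : Real.sqrt (T / (2 * π)) ≤ μ := by
    rw [Real.sqrt_le_left hμR.le, div_le_iff₀ (by positivity)]
    linarith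
  have h2 : 1 / (μ : ℝ) ≤ Real.sqrt (2 * π / T) := by
    rw [show (2 * π / T) = (T / (2 * π))⁻¹ by rw [inv_div], Real.sqrt_inv, one_div]
    exact inv_anti₀ (Real.sqrt_pos.2 (by positivity)) h1
  calc 1 / (μ : ℝ) ^ 2 = (1 / μ) * (1 / μ) := by rw [sq, one_div_mul_one_div]
    _ ≤ Real.sqrt (2 * π / T) * (1 / μ) := mul_le_mul_of_nonneg_right h2 (by positivity)

end Literature.NumberTheory.LFunctions.BCH
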